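import Literature.Analysis.FluidPDE.TypeIAncientMild
import Literature.Analysis.FluidPDE.ClassicalSolution
import HarnessLib

/-!
# Crux `FarPastLedger` (stmt-NavierStokesRegularity-14060), line `uloc-gronwall-transplant`, negative side: the four `A_C`-quantified stubs are X-safe

Negative-side (cdisprove, D-0016) META-LEMMAS about the lead's skeleton
`Cruxes/FarPastLedger/Lines/uloc_gronwall_transplant.lean` (sha d1056eeb).  Four of its seven stubs —
LFL `stub_fplLinearFluxLedger`, GRADP `stub_fplPressureGradientBound`, MD `stub_fplMeanDisplacement`,
PIN `stub_fplPinning` — quantify over the class `A_C = IsTypeIAncientMild C` (and a classical pressure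
of the element on a window).  This file proves that each of the four statements (mirrored VERBATIM as
`Stub…Statement`) FOLLOWS from Liouville over the class (`ClassLiouvilleStatement`, = the route target
X `Theses.SymmetryModuliCount.TypeIAncientLiouville` read through `isTypeIAncientMild_iff`):

* `stubLFL_of_classLiouville`, `stubGRADP_of_classLiouville`, `stubMD_of_classLiouville`,
  `stubPIN_of_classLiouville`;
* contrapositively (`exists_ne_zero_of_not_stubLFL`, …): a counterexample to any of them is a NONZERO
  Type-I KNSS-mild ancient solution, i.e. a solution of the open Type-I Liouville problem — exactly as
  for the crux itself (`Negative/Scaling.lean`, `exists_ne_zero_of_not_farPastLedger`).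

So these four stubs cannot be refuted by an explicit field; only COV, SHELL (elementary, true) and HA
(`stub_fplSlicePressure`, pure harmonic analysis; see `Negative/SlicePressure.lean` for its
load-bearing gradient bound) are exposed to small-model attacks.  The key computation is
`gradient_pressure_eq_zero_of_velocity_eq_zero`: a classical pressure of the ZERO velocity on an open
window has vanishing gradient (momentum equation), which discharges GRADP and PIN at `u = 0`.

Nothing here asserts a route statement; `--supports` the crux item.
-/

noncomputable section

set_option linter.dupNamespace false

namespace Summit.NavierStokesRegularity.NavierStokesRegularity.Theorems.FarPastLedger.Negative

open MeasureTheory Set Filter Metric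
open scoped Topology Laplacian
open Literature.Analysis.FluidPDE

local notation "ℝ³" => EuclideanSpace ℝ (Fin 3)

/-- Liouville over the class (= X): every element of every `A_C` vanishes on `t < 0`.  (Same body as
`Negative.Scaling.ClassLiouville`; restated to keep this file import-light.) -/
def ClassLiouvilleStatement : Prop :=
  ∀ (C : ℝ) (u : ℝ → ℝ³ → ℝ³), IsTypeIAncientMild C u → ∀ t < 0, ∀ x, u t x = 0

/-! ## The pressure of the zero velocity has zero gradient -/

/-- **Momentum equation at `u ≡ 0`.** If `(u, p)` is a classical Navier–Stokes pair (`ν = 1`, `f = 0`)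
on the open window `(t₀, 0)` and `u(t, ·) = 0` for all `t < 0`, then `∇p(τ, ·) = 0` for `τ` in the
window: `∂ₜu`, `(u·∇)u` and `Δu` all vanish. -/
theorem gradient_pressure_eq_zero_of_velocity_eq_zero {u : ℝ → ℝ³ → ℝ³} {p : ℝ → ℝ³ → ℝ} {t₀ : ℝ}
    (hcl : IsClassicalNSSolutionOn (Ioo t₀ 0) 1 0 u p) (h0 : ∀ t < 0, ∀ x, u t x = 0)
    {τ : ℝ} (hτ : τ ∈ Ioo t₀ 0) (x : ℝ³) : gradient (p τ) x = 0 := by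
  have hmom := hcl.momentum τ hτ x
  have hslice : u τ = fun _ => (0 : ℝ³) := funext (h0 τ hτ.2)
  have hder : timeDerivWithin (Ioo t₀ 0) u τ x = 0 := by
    rw [timeDerivWithin_apply]
    have hc : EqOn (fun s => u s x) (fun _ => (0 : ℝ³)) (Ioo t₀ 0) := fun s hs => h0 s hs.2 x
    rw [derivWithin_congr hc (h0 τ hτ.2 x)]
    simp
  have hconv : convect (u τ) (u τ) x = 0 := by
    rw [convect_apply, hslice]
    simp
  have hlap : (Δ (u τ)) x = 0 := by
    rw [hslice]
    exact congrFun (InnerProductSpace.laplacian_const (E := ℝ³) (c := (0 : ℝ³))) x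
  rw [hder, hconv, hlap] at hmom
  simpa using hmom

/-- Consequently `fderiv ℝ (p τ) x = 0` (the dual of the gradient). -/
theorem fderiv_pressure_eq_zero_of_velocity_eq_zero {u : ℝ → ℝ³ → ℝ³} {p : ℝ → ℝ³ → ℝ} {t₀ : ℝ}
    (hcl : IsClassicalNSSolutionOn (Ioo t₀ 0) 1 0 u p) (h0 : ∀ t < 0, ∀ x, u t x = 0)
    {τ : ℝ} (hτ : τ ∈ Ioo t₀ 0) (x : ℝ³) : fderiv ℝ (p τ) x = 0 := by
  have hg := gradient_pressure_eq_zero_of_velocity_eq_zero hcl h0 hτ x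
  have e := (InnerProductSpace.toDual ℝ ℝ³).apply_symm_apply (fderiv ℝ (p τ) x)
  rw [← e]
  change (InnerProductSpace.toDual ℝ ℝ³) (gradient (p τ) x) = 0
  rw [hg, map_zero]

/-! ## GRADP -/

/-- VERBATIM the statement of stub GRADP `stub_fplPressureGradientBound`. -/
def StubGRADPStatement : Prop :=
  ∀ (C : ℝ) (u : ℝ → EuclideanSpace ℝ (Fin 3) → EuclideanSpace ℝ (Fin 3)),
    Literature.Analysis.FluidPDE.IsTypeIAncientMild C u →
    ∀ (t₀ : ℝ) (p : ℝ → EuclideanSpace ℝ (Fin 3) → ℝ),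
    Literature.Analysis.FluidPDE.IsClassicalNSSolutionOn (Set.Ioo t₀ 0) 1 0 u p →
    ∀ τ ∈ Set.Ioo t₀ 0, ∃ L : ℝ, ∀ x : EuclideanSpace ℝ (Fin 3), ‖fderiv ℝ (p τ) x‖ ≤ L

/-- **GRADP is X-safe**: it holds over a class all of whose elements vanish (`L = 0`). -/
theorem stubGRADP_of_classLiouville (hL : ClassLiouvilleStatement) : StubGRADPStatement := by
  intro C u hu t₀ p hp τ hτ
  refine ⟨0, fun x => ?_⟩
  rw [fderiv_pressure_eq_zero_of_velocity_eq_zero hp (hL C u hu) hτ x, norm_zero]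

/-! ## MD -/

/-- VERBATIM the statement of stub MD `stub_fplMeanDisplacement`. -/
def StubMDStatement : Prop :=
  ∀ (C : ℝ) (u : ℝ → EuclideanSpace ℝ (Fin 3) → EuclideanSpace ℝ (Fin 3)),
    Literature.Analysis.FluidPDE.IsTypeIAncientMild C u →
    ∀ t₁ t₂ : ℝ, t₁ < t₂ → t₂ < 0 →
    Filter.Tendsto (fun r : ℝ => (r ^ 3)⁻¹ •
      ∫ x, (((⟨1, 2, zero_lt_one, one_lt_two⟩ : ContDiffBump (0 : EuclideanSpace ℝ (Fin 3))) :
          EuclideanSpace ℝ (Fin 3) → ℝ) (r⁻¹ • x)) • (u t₂ x - u t₁ x))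
      Filter.atTop (nhds 0)

/-- **MD is X-safe**: the displacement of the zero field vanishes identically. -/
theorem stubMD_of_classLiouville (hL : ClassLiouvilleStatement) : StubMDStatement := by
  intro C u hu t₁ t₂ h12 h2
  have h1 : t₁ < 0 := h12.trans h2
  have hzero : (fun r : ℝ => (r ^ 3)⁻¹ •
      ∫ x, (((⟨1, 2, zero_lt_one, one_lt_two⟩ : ContDiffBump (0 : ℝ³)) : ℝ³ → ℝ) (r⁻¹ • x)) •
        (u t₂ x - u t₁ x)) = fun _ => 0 := by
    funext r
    have : ∀ x, u t₂ x - u t₁ x = 0 := fun x => by rw [hL C u hu t₂ h2 x, hL C u hu t₁ h1 x, sub_zero]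
    simp only [this, smul_zero, integral_zero]
  rw [hzero]
  exact tendsto_const_nhds

/-! ## PIN -/

/-- VERBATIM the statement of stub PIN `stub_fplPinning`. -/
def StubPINStatement : Prop :=
  ∀ (C : ℝ) (u : ℝ → EuclideanSpace ℝ (Fin 3) → EuclideanSpace ℝ (Fin 3)),
    Literature.Analysis.FluidPDE.IsTypeIAncientMild C u →
    ∀ (t₀ : ℝ) (p : ℝ → EuclideanSpace ℝ (Fin 3) → ℝ),
    Literature.Analysis.FluidPDE.IsClassicalNSSolutionOn (Set.Ioo t₀ 0) 1 0 u p →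
    ∀ (a : ℝ → EuclideanSpace ℝ (Fin 3)) (κ : ℝ → ℝ),
    (∀ τ ∈ Set.Ioo t₀ 0, ∀ r : ℝ, 1 ≤ r →
      ‖(∫ x, ((⟨1, 2, zero_lt_one, one_lt_two⟩ : ContDiffBump (0 : EuclideanSpace ℝ (Fin 3))) :
            EuclideanSpace ℝ (Fin 3) → ℝ) (r⁻¹ • x))⁻¹ •
          (∫ x, (((⟨1, 2, zero_lt_one, one_lt_two⟩ :
              ContDiffBump (0 : EuclideanSpace ℝ (Fin 3))) : EuclideanSpace ℝ (Fin 3) → ℝ)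
                (r⁻¹ • x)) • gradient (p τ) x) - a τ‖ ≤ κ τ / r) →
    (∀ τ₁ τ₂ : ℝ, t₀ < τ₁ → τ₂ < 0 → ∃ K : ℝ, ∀ τ ∈ Set.Icc τ₁ τ₂, κ τ ≤ K) →
    (∀ t₁ t₂ : ℝ, t₁ < t₂ → t₂ < 0 →
      Filter.Tendsto (fun r : ℝ => (r ^ 3)⁻¹ •
        ∫ x, (((⟨1, 2, zero_lt_one, one_lt_two⟩ : ContDiffBump (0 : EuclideanSpace ℝ (Fin 3))) :
            EuclideanSpace ℝ (Fin 3) → ℝ) (r⁻¹ • x)) • (u t₂ x - u t₁ x))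
        Filter.atTop (nhds 0)) →
    ∀ τ ∈ Set.Ioo t₀ 0, a τ = 0

/-- `‖v‖ ≤ κ / r` for all `r ≥ 1` forces `v = 0`. -/
theorem eq_zero_of_norm_le_div {v : ℝ³} {κ : ℝ} (h : ∀ r : ℝ, 1 ≤ r → ‖v‖ ≤ κ / r) : v = 0 := by
  have hlim : Tendsto (fun r : ℝ => κ / r) atTop (𝓝 0) := by
    simpa [div_eq_mul_inv] using tendsto_inv_atTop_zero.const_mul κ
  have hle : ‖v‖ ≤ 0 :=
    le_of_tendsto_of_tendsto tendsto_const_nhds hlim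
      ((eventually_ge_atTop (1 : ℝ)).mono fun r hr => h r hr)
  exact norm_le_zero_iff.1 hle

/-- **PIN is X-safe**: over a class of vanishing elements every classical pressure has `∇p = 0` on
the window, so the scale-`r` averages vanish and the rate hypothesis alone pins `a τ = 0`. -/
theorem stubPIN_of_classLiouville (hL : ClassLiouvilleStatement) : StubPINStatement := by
  intro C u hu t₀ p hp a κ hrate _ _ τ hτ
  refine eq_zero_of_norm_le_div (κ := κ τ) fun r hr => ?_
  have key := hrate τ hτ r hr
  have hg : ∀ x, gradient (p τ) x = 0 := fun x =>
    gradient_pressure_eq_zero_of_velocity_eq_zero hp (hL C u hu) hτ x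
  simp only [hg, smul_zero, integral_zero, zero_sub, norm_neg] at key
  exact key

/-! ## LFL -/

/-- VERBATIM the statement of stub LFL `stub_fplLinearFluxLedger` (the lever). -/
def StubLFLStatement : Prop :=
  ∀ (c₀ cS : ℝ), ∃ N : ℝ, 0 ≤ N ∧
    ∀ (C : ℝ) (u : ℝ → EuclideanSpace ℝ (Fin 3) → EuclideanSpace ℝ (Fin 3)),
    Literature.Analysis.FluidPDE.IsTypeIAncientMild C u →
    ∀ (t₀ : ℝ) (p : ℝ → EuclideanSpace ℝ (Fin 3) → ℝ),
    Literature.Analysis.FluidPDE.IsClassicalNSSolutionOn (Set.Ioo t₀ 0) 1 0 u p →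
    (∀ τ ∈ Set.Ioo t₀ 0, ∀ x₀ : EuclideanSpace ℝ (Fin 3),
      ∃ (c : ℝ) (p₁ p₂ : EuclideanSpace ℝ (Fin 3) → ℝ),
      (∀ x ∈ Metric.ball x₀ 2, p τ x = c + p₁ x + p₂ x) ∧
      MeasureTheory.MemLp p₁ 2 MeasureTheory.volume ∧
      ∫ x, p₁ x ^ 2 ≤ c₀ * (C ^ 2 / (-τ)) * ∫ x in Metric.ball x₀ 4, ‖u τ x‖ ^ 2 ∧
      ∀ x ∈ Metric.ball x₀ 2, DifferentiableAt ℝ p₂ x ∧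
        ‖fderiv ℝ p₂ x‖ ≤ c₀ * ∫ y in (Metric.ball x₀ 3)ᶜ, ‖u τ y‖ ^ 2 / ‖y - x₀‖ ^ 4) →
    (∀ (ρ : ℝ), 1 ≤ ρ → ∀ (g : EuclideanSpace ℝ (Fin 3) → ℝ), Continuous g → (∀ x, 0 ≤ g x) →
      ∀ (B : ℝ) (x₁ : EuclideanSpace ℝ (Fin 3)),
      (∀ z : EuclideanSpace ℝ (Fin 3), ∫ x in Metric.ball z 1, g x ≤ B) →
      ∫ x in Metric.ball x₁ ρ, g x ≤ 125 * ρ ^ 3 * B) →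
    (∀ (g : EuclideanSpace ℝ (Fin 3) → ℝ), Continuous g → (∀ x, 0 ≤ g x) → (∃ M : ℝ, ∀ x, g x ≤ M) →
      ∀ (B : ℝ) (x₁ : EuclideanSpace ℝ (Fin 3)),
      (∀ z : EuclideanSpace ℝ (Fin 3), ∫ x in Metric.ball z 1, g x ≤ B) →
      MeasureTheory.IntegrableOn (fun y => g y / ‖y - x₁‖ ^ 4) (Metric.ball x₁ 3)ᶜ
          MeasureTheory.volume ∧
        ∫ y in (Metric.ball x₁ 3)ᶜ, g y / ‖y - x₁‖ ^ 4 ≤ cS * B) →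
    ∀ (s' t' : ℝ), t₀ < s' → s' ≤ t' → t' < 0 → ∀ (F₀ B : ℝ), 0 ≤ B →
    (∀ z : EuclideanSpace ℝ (Fin 3), ∫ x in Metric.ball z 1, ‖u s' x‖ ^ 2 ≤ F₀) →
    (∀ τ ∈ Set.Icc s' t', ∀ z : EuclideanSpace ℝ (Fin 3), ∫ x in Metric.ball z 1, ‖u τ x‖ ^ 2 ≤ B) →
    ∀ x₀ : EuclideanSpace ℝ (Fin 3),
      ∫ x in Metric.ball x₀ 1, ‖u t' x‖ ^ 2 ≤
        N * F₀ + N * B * ((t' - s') + C * (Real.sqrt (-s') - Real.sqrt (-t')))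

/-- **LFL is X-safe**: with `N = 1` it holds over a class of vanishing elements (the left side is `0`,
the right side is `≥ 0`: `F₀ ≥ 0` from its own hypothesis, `B ≥ 0`, `t' ≥ s'`, `C ≥ 0`,
`√(−s') ≥ √(−t')`). -/
theorem stubLFL_of_classLiouville (hL : ClassLiouvilleStatement) : StubLFLStatement := by
  intro c₀ cS
  refine ⟨1, zero_le_one, ?_⟩
  intro C u hu t₀ p _ _ _ _ s' t' _ hst ht F₀ B hB hF _ x₀
  have hs : s' < 0 := lt_of_le_of_lt hst ht
  have h0 : ∀ x, ‖u t' x‖ ^ 2 = 0 := fun x => by rw [hL C u hu t' ht x, norm_zero]; ring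
  have hF₀ : 0 ≤ F₀ := le_trans (integral_nonneg fun x => by positivity) (hF x₀)
  have hC : 0 ≤ C := hu.nonneg
  have hsq : Real.sqrt (-t') ≤ Real.sqrt (-s') := Real.sqrt_le_sqrt (by linarith)
  simp only [h0, integral_zero, one_mul]
  have : 0 ≤ B * ((t' - s') + C * (Real.sqrt (-s') - Real.sqrt (-t'))) := by
    apply mul_nonneg hB
    have := mul_nonneg hC (sub_nonneg.2 hsq)
    linarith
  linarith

/-! ## Contrapositives: a counterexample to any of the four is a nonzero element of some `A_C` -/

/-- Unfolding `¬ ClassLiouvilleStatement`. -/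
theorem exists_ne_zero_of_not_classLiouville (h : ¬ ClassLiouvilleStatement) :
    ∃ (C : ℝ) (u : ℝ → ℝ³ → ℝ³), IsTypeIAncientMild C u ∧ ∃ t < 0, ∃ x, u t x ≠ 0 := by
  unfold ClassLiouvilleStatement at h
  push Not at h
  exact h

/-- A counterexample to LFL is a nonzero element of some `A_C` (an open-problem witness). -/
theorem exists_ne_zero_of_not_stubLFL (h : ¬ StubLFLStatement) :
    ∃ (C : ℝ) (u : ℝ → ℝ³ → ℝ³), IsTypeIAncientMild C u ∧ ∃ t < 0, ∃ x, u t x ≠ 0 :=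
  exists_ne_zero_of_not_classLiouville fun hL => h (stubLFL_of_classLiouville hL)

/-- A counterexample to GRADP is a nonzero element of some `A_C` (an open-problem witness). -/
theorem exists_ne_zero_of_not_stubGRADP (h : ¬ StubGRADPStatement) :
    ∃ (C : ℝ) (u : ℝ → ℝ³ → ℝ³), IsTypeIAncientMild C u ∧ ∃ t < 0, ∃ x, u t x ≠ 0 :=
  exists_ne_zero_of_not_classLiouville fun hL => h (stubGRADP_of_classLiouville hL)

/-- A counterexample to MD is a nonzero element of some `A_C` (an open-problem witness). -/
theorem exists_ne_zero_of_not_stubMD (h : ¬ StubMDStatement) :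
    ∃ (C : ℝ) (u : ℝ → ℝ³ → ℝ³), IsTypeIAncientMild C u ∧ ∃ t < 0, ∃ x, u t x ≠ 0 :=
  exists_ne_zero_of_not_classLiouville fun hL => h (stubMD_of_classLiouville hL)

/-- A counterexample to PIN is a nonzero element of some `A_C` (an open-problem witness). -/
theorem exists_ne_zero_of_not_stubPIN (h : ¬ StubPINStatement) :
    ∃ (C : ℝ) (u : ℝ → ℝ³ → ℝ³), IsTypeIAncientMild C u ∧ ∃ t < 0, ∃ x, u t x ≠ 0 :=
  exists_ne_zero_of_not_classLiouville fun hL => h (stubPIN_of_classLiouville hL)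

end Summit.NavierStokesRegularity.NavierStokesRegularity.Theorems.FarPastLedger.Negative

end
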